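import Summits.RiemannHypothesis.RiemannHypothesis.Theorems.WeilParityEvenWinsBeyondArchParityCell91
import Summits.RiemannHypothesis.RiemannHypothesis.Theorems.GroundBartaEvenWinsBeyondArchUpper91Sharp
import Summits.RiemannHypothesis.RiemannHypothesis.Theorems.WeilFormatCDataO94OddRung
import Summits.RiemannHypothesis.RiemannHypothesis.Theorems.GroundBartaEvenWinsBeyondArchUpper94Sharp
import Summits.RiemannHypothesis.RiemannHypothesis.Theorems.WeilFormatCDataO97OddRung
import Summits.RiemannHypothesis.RiemannHypothesis.Theorems.GroundBartaEvenWinsBeyondArchUpper9729Sharp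
import Summits.RiemannHypothesis.RiemannHypothesis.Theorems.WeilFormatCDataO100OddRung
import Summits.RiemannHypothesis.RiemannHypothesis.Theorems.GroundBartaEvenWinsBeyondArchUpper100Sharp
import Summits.RiemannHypothesis.RiemannHypothesis.Theorems.WeilFormatCDataO102BOddRung
import Summits.RiemannHypothesis.RiemannHypothesis.Theorems.GroundBartaEvenWinsBeyondArchUpper102Sharp
import Summits.RiemannHypothesis.RiemannHypothesis.Theorems.WeilFormatCDataO1035OddRung
import Summits.RiemannHypothesis.RiemannHypothesis.Theorems.WeilGroundStateGroundStateSimpleEvenCellTransfer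
import Literature.NumberTheory.LFunctions.WeilGroundEnergyParitySplit
import HarnessLib

/-!
# RiemannHypothesis / GroundBarta — the parity ladder: PARITY CELL 14 CLOSED — `NoParityCrossing` certified on `(0, 207/200]`

Helper file (`--supports stmt-RiemannHypothesis-18085`, `NoParityCrossing`), RH-free.  Unit `sr-gb-rung-a` (generator `mk_closure.py`, prover A g24).
Every cell `(b, c]` of the ladder beyond `91/100` is re-derived INLINE (`GroundStateSimpleEven.weilWindowSimpleEven_on_cell_of_le`: `ε`, `ε_od`
antitone, `U(b) < 2⁻ᴷ ≤ ε_od(c)`) from its two BUILT tree facts, on top of `weilWindowSimpleEven_upTo_91` (`…ParityCell91`, cells 1–9):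
* cell 10 `(…, 47/50]`: `trialUpper91sharp` (`…Upper91Sharp`, `ε ≤ 2.59e-23`) + `WeilFormatCData.O94.weilOddGroundEnergy_94_ge_inv_two_pow_75` (`WeilFormatCDataO94OddRung`, `2⁻75 ≤ ε_od(47/50)`);
* cell 11 `(…, 9729/10000]`: `trialUpper94sharp` (`…Upper94Sharp`, `ε ≤ 2.32e-25`) + `WeilFormatCData.O97.weilOddGroundEnergy_9729_ge_inv_two_pow_81` (`WeilFormatCDataO97OddRung`, `2⁻81 ≤ ε_od(9729/10000)`);
* cell 12 `(…, 1]`: `trialUpper9729sharp` (`…Upper9729Sharp`, `ε ≤ 9.9e-28`) + `WeilFormatCData.O100.weilOddGroundEnergy_one_ge_inv_two_pow_88` (`WeilFormatCDataO100OddRung`, `2⁻88 ≤ ε_od(1)`);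
* cell 13 `(…, 51/50]`: `trialUpper100sharp` (`…Upper100Sharp`, `ε ≤ 5.57e-29`) + `WeilFormatCData.O102B.weilOddGroundEnergy_102_ge_inv_two_pow_93` (`WeilFormatCDataO102BOddRung`, `2⁻93 ≤ ε_od(51/50)`);
* cell 14 `(…, 207/200]`: `trialUpper102sharp` (`…Upper102Sharp`, `ε ≤ 1.8e-30`) + `WeilFormatCData.O1035.weilOddGroundEnergy_1035_ge_inv_two_pow_97` (`WeilFormatCDataO1035OddRung`, `2⁻97 ≤ ε_od(207/200)`);

* `weilWindowSimpleEven_upTo_1035` — for every `0 < a ≤ 207/200` the ground state of the windowed Weil form is simple and even;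
* `weilEvenGroundEnergy_lt_weilOddGroundEnergy_upTo_1035`, `tailSimpleEven_upTo_1035`, `noParityCrossing_upTo_1035`, `weilWindowSimpleEven_on_cell14_1035`.

Standard axioms; nothing is defined; no RH claim (a finite-range parity certificate).
-/

set_option linter.dupNamespace false

noncomputable section

open Set MeasureTheory

namespace Summit.RiemannHypothesis.RiemannHypothesis.Theorems.EvenWinsBeyondArch

open Literature.NumberTheory.LFunctions

/-- **Parity cell 14 closed: the ladder reaches `207/200`.**  For every window `0 < a ≤ 207/200` the windowed Weil form has a simple,
even ground state. [folklore] -/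
theorem weilWindowSimpleEven_upTo_1035 : ∀ a : ℝ, 0 < a → a ≤ 207 / 200 → WeilWindowSimpleEven a := by
  intro a ha hac
  rcases le_or_gt a ((51 : ℝ) / 50) with hab14 | hba14
  · rcases le_or_gt a (1) with hab13 | hba13
    · rcases le_or_gt a (9729 / 10000) with hab12 | hba12
      · rcases le_or_gt a (47 / 50) with hab11 | hba11
        · rcases le_or_gt a (91 / 100) with hab10 | hba10
          · exact weilWindowSimpleEven_upTo_91 a ha hab10
          · have hU10 := trialUpper91sharp
            have hL10 := WeilFormatCData.O94.weilOddGroundEnergy_94_ge_inv_two_pow_75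
            have hUL10 : (2589 / 100000000000000000000000000 : ℝ) < (1 / 2 ^ 75 : ℝ) := by norm_num
            exact GroundStateSimpleEven.weilWindowSimpleEven_on_cell_of_le (b := 91 / 100) (c := 47 / 50) (by norm_num) hUL10 hU10
              (fun _ hg hs hn ho ↦ hL10.trans (weilOddGroundEnergy_le hg hs ho hn)) hba10.le hab11
        · have hU11 := trialUpper94sharp
          have hL11 := WeilFormatCData.O97.weilOddGroundEnergy_9729_ge_inv_two_pow_81
          have hUL11 : (2322 / 10000000000000000000000000000 : ℝ) < (1 / 2 ^ 81 : ℝ) := by norm_num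
          exact GroundStateSimpleEven.weilWindowSimpleEven_on_cell_of_le (b := 47 / 50) (c := 9729 / 10000) (by norm_num) hUL11 hU11
            (fun _ hg hs hn ho ↦ hL11.trans (weilOddGroundEnergy_le hg hs ho hn)) hba11.le hab12
      · have hU12 := trialUpper9729sharp
        have hL12 := WeilFormatCData.O100.weilOddGroundEnergy_one_ge_inv_two_pow_88
        have hUL12 : (9899 / 10000000000000000000000000000000 : ℝ) < (1 / 2 ^ 88 : ℝ) := by norm_num
        exact GroundStateSimpleEven.weilWindowSimpleEven_on_cell_of_le (b := 9729 / 10000) (c := 1) (by norm_num) hUL12 hU12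
          (fun _ hg hs hn ho ↦ hL12.trans (weilOddGroundEnergy_le hg hs ho hn)) hba12.le hab13
    · have hU13 := trialUpper100sharp
      have hL13 := WeilFormatCData.O102B.weilOddGroundEnergy_102_ge_inv_two_pow_93
      have hUL13 : (5566 / 100000000000000000000000000000000 : ℝ) < (1 / 2 ^ 93 : ℝ) := by norm_num
      exact GroundStateSimpleEven.weilWindowSimpleEven_on_cell_of_le (b := 1) (c := (51 : ℝ) / 50) (by norm_num) hUL13 hU13
        (fun _ hg hs hn ho ↦ hL13.trans (weilOddGroundEnergy_le hg hs ho hn)) hba13.le hab14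
  · have hU14 := trialUpper102sharp
    have hL14 := WeilFormatCData.O1035.weilOddGroundEnergy_1035_ge_inv_two_pow_97
    have hUL14 : (18 / 10000000000000000000000000000000 : ℝ) < (1 / 2 ^ 97 : ℝ) := by norm_num
    exact GroundStateSimpleEven.weilWindowSimpleEven_on_cell_of_le (b := (51 : ℝ) / 50) (c := (207 : ℝ) / 200) (by norm_num) hUL14 hU14
      (fun _ hg hs hn ho ↦ hL14.trans (weilOddGroundEnergy_le hg hs ho hn)) hba14.le hac

/-- The strict parity order `ε_ev(a) < ε_od(a)` for every `0 < a ≤ 207/200`. [folklore] -/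
theorem weilEvenGroundEnergy_lt_weilOddGroundEnergy_upTo_1035 {a : ℝ} (ha : 0 < a) (hle : a ≤ 207 / 200) :
    weilEvenGroundEnergy a < weilOddGroundEnergy a :=
  (weilWindowSimpleEven_iff_weilEvenGroundEnergy_lt ha).1 (weilWindowSimpleEven_upTo_1035 a ha hle)

/-- Tail shape of item 18085 up to `207/200`: simple even ground states on every window `log 2 < a ≤ 207/200`. [folklore] -/
theorem tailSimpleEven_upTo_1035 : ∀ a : ℝ, Real.log 2 < a → a ≤ 207 / 200 → WeilWindowSimpleEven a :=
  fun a ha hle ↦ weilWindowSimpleEven_upTo_1035 a ((Real.log_pos (by norm_num)).trans ha) hle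

/-- **Item 18085's statement restricted to the certified range**: for every window `(log 3)/2 < a ≤ 207/200` the even and odd
sector bottoms do not coincide, `ε_ev(a) ≠ ε_od(a)` — the crux `NoParityCrossing` verified on the finite range of the parity
ladder (cells 1–14). [folklore] -/
theorem noParityCrossing_upTo_1035 : ∀ a : ℝ, Real.log 3 / 2 < a → a ≤ 207 / 200 →
    weilEvenGroundEnergy a ≠ weilOddGroundEnergy a :=
  fun a ha hle ↦ (weilEvenGroundEnergy_lt_weilOddGroundEnergy_upTo_1035
    ((div_pos (Real.log_pos (by norm_num)) two_pos).trans ha) hle).ne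

/-- Simple even ground states on every window of cell 14, `(51 : ℝ) / 50 ≤ a ≤ 207/200`. [folklore] -/
theorem weilWindowSimpleEven_on_cell14_1035 {a : ℝ} (h1 : ((51 : ℝ) / 50 : ℝ) ≤ a) (hle : a ≤ 207 / 200) : WeilWindowSimpleEven a :=
  weilWindowSimpleEven_upTo_1035 a (lt_of_lt_of_le (by norm_num) h1) hle

end Summit.RiemannHypothesis.RiemannHypothesis.Theorems.EvenWinsBeyondArch

end
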